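/-
Origin: expansion seat `prover-pub-hodgecm-mc-binder-1-g13-0`, handover #68 2026-08-20T14:04:58Z md5 de77cad1bac2 (r2; NEW additive KERNEL leaf; imports #67 + HypCensus/OmgInsVacuum; needs S5b #S1/#S2/#S7 landed; drops ⇒ {#69}) (`HOME/mc/pub-hodgecm-mc-binder-1-g13/stage52s5b/HodgeCM/Model/Binders/Real34HarchPin.lean`, md5 de77cad1bac2, 162 lines);
landed by the second packager p2 gen 8 (p2-g8) in gate run 52 as `HodgeCM/Model/Binders/Real34HarchPin.lean` (verbatim).
-/
/-
Origin: speedrun cell pub-hodgecm, MODEL-CONSTRUCTION sub-cell, unit pub-hodgecm-mc-binder-1-g13 (BINDER PROVER, gen 13; row 17 `real34`: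
`harch` of the socket `Real34CensusSideT.ofCensus` (#56) AT THE CENSUS DATA, for every torus twist `σ` of binder-2's S5b census `datumAtσ`
— hypothesis-free up to the sign facts of the context), seat prover-pub-hodgecm-mc-binder-1-g13-0, 2026-08-20.  Target in PKG:
HodgeCM/Model/Binders/Real34HarchPin.lean (NEW additive leaf; imports binder-1 `Binders/Real34HarchPoly` (hence `Binders/Real34Harch`,
`Binders/Real34TwistTransport`) and binder-2's `HypCensus/OmgInsVacuum` (`placePoly_vacuum`); needs binder-2's RUN-51 S5b table (`datumAtσ`, `printedAtσ`)).
KERNEL ONLY: theorems; 0 records, nothing cited, 0 `def … : Prop`; MODEL-N ±0; E unchanged.  Nothing here is a claim of the manuscripts under adjudication.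
-/
import Summits.HodgeConjecture.HodgeCM.Model.Binders.Real34HarchPoly
import Summits.HodgeConjecture.HodgeCM.Model.HypCensus.OmgInsVacuum

/-!
# Row 17's `harch` at the census data `datumAtσ V S jD (jIOf V S hW) σ` (every torus twist `σ`; `σ = 1`: `datumAt`)

* `not_conjSwapAt_placeUp_cmPlace` — theta-3's relabelling bit is NOT set at the place under `ι₁` (W is definite there: `hW`, and the
  primed plane has the same sign there, (K7) `re_dW'_zero_pos/neg`);
* `insPoly_φ₀_datumAtσ` (`σ = 1`: `insPoly_φ₀_datumAt`) — binder-2's printed vacuum inserts the `ι₁` determinant letter alone, whatever the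
  twist does at the `Σ₁₂` places: `insPoly … φ₀ = rename (atPlace v₁) (rename jIAt detZ)` (`placePoly_vacuum`, S5b `datumAt_of_eq`,
  `datumAt_kind_ne_iota_of_ne`; binder-2's RUN-52 `InsVacuumPoly.prod_vacuumPoly_datumAtσ` in `insPoly` currency);
* **`harch_datumAtσ`** (`σ = 1`: **`harch_datumAt`**) — the `harch` hypothesis of `Real34CensusSideT.ofCensus` (#56) / `ofCensusσ` at
  `datum := datumAtσ V S jD (jIOf V S hW) σ`, exponents `m₁ m₂`, line families `Z₂ := lineFam V S 0 hpos₂`, `Z₃ := lineFam V S 1 hpos₃` (carch-1's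
  #CA56 literals): NO hypothesis beyond the context's sign facts `hW`, `hpos₂`, `hpos₃`.
-/

set_option autoImplicit false

noncomputable section

open scoped Matrix Classical TensorProduct SchwartzMap

namespace HodgeCM.Model

open MvPolynomial (rename X)
open NumberField NumberField.InfinitePlace NumberField.mixedEmbedding
open Literature.NumberTheory.Automorphic Literature.NumberTheory.Automorphic.UnitaryGroup Literature.NumberTheory.Weil1964
open Literature.RepresentationTheory.KonnoKonno2007 Literature.RepresentationTheory.KonnoKonno2007.RealDualPair
open Literature.NumberTheory.GelbartRogawski1991 Literature.NumberTheory.GelbartRogawski1991.UnitaryDualPair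
open Literature.RepresentationTheory (atPlace)
open Literature.Analysis.SegalBargmann
open HodgeCM HodgeCM.Adelic HodgeCM.PerL34 HodgeCM.Model.HypCensus HodgeCM.Model.ArchSideTerm
open HodgeCM.PerL34.Fock HodgeCM.PerL34.Fock.PrintDict

section Pin

variable {L : CMField} {ι₁ : L →+* ℂ} (V : HermSpace3 L ι₁) (S : StubTree.SeesawDatum L)
variable (hW : (∀ j, 0 < (ι₁ ((dW S) j)).re) ∨ ∀ j, (ι₁ ((dW S) j)).re < 0)

/-- the letters through the place `placeUp v₁` over `v₁` have the real parts they have through `ι₁`. -/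
theorem re_embedding_placeUp_cmPlace_dW (j : Fin 2) :
    ((placeUp (L := L) (HypCensus.cmPlace (L : Type) ι₁)).embedding (dW S j)).re = (ι₁ (dW S j)).re := by
  rw [re_embedding_placeUp_dW]
  have h := embedding_of_isReal_cmRealVec (L : Type) (HypCensus.cmPlace (L : Type) ι₁) ι₁ rfl (dW S) (dW_real S) j
  rw [← Complex.ofReal_re (embedding_of_isReal _ _), h]

include hW in
/-- **theta-3's relabelling bit is not set at the place under `ι₁`**: `W` is definite there, so the primed plane has the same sign there. -/
theorem not_conjSwapAt_placeUp_cmPlace : ¬ conjSwapAt S (placeUp (L := L) (HypCensus.cmPlace (L : Type) ι₁)) := by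
  intro h
  apply h
  rcases hW with hp | hn
  · have h0 : 0 < ((placeUp (L := L) (HypCensus.cmPlace (L : Type) ι₁)).embedding (dW S 0)).re := by
      rw [re_embedding_placeUp_cmPlace_dW]; exact hp 0
    have h1 : 0 < ((placeUp (L := L) (HypCensus.cmPlace (L : Type) ι₁)).embedding (dW S 1)).re := by
      rw [re_embedding_placeUp_cmPlace_dW]; exact hp 1
    exact ⟨fun _ => re_dW'_zero_pos S _ h0 h1, fun _ => h0⟩
  · have h0 : ((placeUp (L := L) (HypCensus.cmPlace (L : Type) ι₁)).embedding (dW S 0)).re < 0 := by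
      rw [re_embedding_placeUp_cmPlace_dW]; exact hn 0
    have h1 : ((placeUp (L := L) (HypCensus.cmPlace (L : Type) ι₁)).embedding (dW S 1)).re < 0 := by
      rw [re_embedding_placeUp_cmPlace_dW]; exact hn 1
    exact ⟨fun h' => absurd h0 (not_lt.2 h'.le), fun h' => absurd (re_dW'_zero_neg S _ h0 h1) (not_lt.2 h'.le)⟩

variable (jD : InfinitePlace (L : Type) → HodgeCM.PerL34.Fock.EqVar → Fin 6) (m₁ m₂ : InfinitePlace (L : Type) → ℤ)
variable (σ : InfinitePlace (L : Type) → Equiv.Perm (Fin 2))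

/-- **the printed vacuum of the `σ`-twisted census inserts the `ι₁` determinant letter alone** (`insPoly` currency; every twist `σ`). -/
theorem insPoly_φ₀_datumAtσ :
    HypCensus.insPoly (cmPlacesEquiv (L : Type))
        (HypCensus.embOf (L : Type) (frameD V) (frameD_real V) (dW S) (dW_real S) ι₁ (datumAtσ V S jD (jIOf V S hW) σ) m₁ m₂)
        (printedAtσ V S hW jD m₁ m₂ σ).φ₀ =
      rename (atPlace (HypCensus.cmPlace (L : Type) ι₁))
        (rename (jIAt (L : Type) (frameD V) (frameD_real V) (dW S) (dW_real S) ι₁ (frameD_sign_ι₁ V) hW) HodgeCM.PerL34.Fock.detZ) := by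
  -- `φ₀ = ⨂ₜ_b φ⁰_b` (definitional), so `insPoly_tprod` computes the place product of the vacuum place polynomials
  refine (HypCensus.insPoly_tprod (cmPlacesEquiv (L : Type))
    (HypCensus.embOf (L : Type) (frameD V) (frameD_real V) (dW S) (dW_real S) ι₁ (datumAtσ V S jD (jIOf V S hW) σ) m₁ m₂)
    (fun b => (((printedAtσ V S hW jD m₁ m₂ σ).loc b).φ))).trans ?_
  -- every factor is the renamed vacuum polynomial of its kind
  have hfac : ∀ w : {v : InfinitePlace (↥(maximalRealSubfield (L : Type))) // v.IsReal},
      rename (atPlace w) (HypCensus.embOf (L : Type) (frameD V) (frameD_real V) (dW S) (dW_real S) ι₁ (datumAtσ V S jD (jIOf V S hW) σ) m₁ m₂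
        ((cmPlacesEquiv (L : Type)).symm w) (((printedAtσ V S hW jD m₁ m₂ σ).loc ((cmPlacesEquiv (L : Type)).symm w)).φ)) =
      rename (atPlace w) (rename (datumAtσ V S jD (jIOf V S hW) σ ((cmPlacesEquiv (L : Type)).symm w)).idx
        (kindVacPoly (datumAtσ V S jD (jIOf V S hW) σ ((cmPlacesEquiv (L : Type)).symm w)).kind)) :=
    fun w => congrArg (rename (atPlace w)) (placePoly_vacuum (L : Type) (frameD V) (frameD_real V) (dW S) (dW_real S) ι₁
      (datumAtσ V S jD (jIOf V S hW) σ) m₁ m₂ w)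
  rw [Finset.prod_congr rfl fun w _ => hfac w, Finset.prod_eq_single (HypCensus.cmPlace (L : Type) ι₁)]
  · rw [datumAt_of_eq V S jD (jIOf V S hW) ((cmPlacesEquiv (L : Type)).symm (HypCensus.cmPlace (L : Type) ι₁)) (Equiv.apply_symm_apply _ _)]
    rfl
  · intro w _ hw
    have hk : (datumAtσ V S jD (jIOf V S hW) σ ((cmPlacesEquiv (L : Type)).symm w)).kind ≠ .iota :=
      datumAt_kind_ne_iota_of_ne V S jD (jIOf V S hW) ((cmPlacesEquiv (L : Type)).symm w) (by rw [Equiv.apply_symm_apply]; exact hw)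
    rw [kindVacPoly_of_ne_iota hk, map_one, map_one]
  · intro h
    exact absurd (Finset.mem_univ _) h

variable
  (hGR : (cmSplittingDatum (L : Type) finProdFinEquiv (frameD V) (frameD_real V) (frameD_ne V) (dW S) (dW_real S) (dW_ne S)).CompatibleSplitting)
  (η : CMAdelic (L : Type) (frameD V) × CMAdelic (L : Type) (dW S) →* ℂˣ)
  (hpos₂ : 0 < cmXW (L : Type) (frameD V) (lineVec (L : Type) (dW' S 0)) (fun _ => dW'_real S 0) ι₁ (HypCensus.cmPlace (L : Type) ι₁) 0)
  (hpos₃ : 0 < cmXW (L : Type) (frameD V) (lineVec (L : Type) (dW' S 1)) (fun _ => dW'_real S 1) ι₁ (HypCensus.cmPlace (L : Type) ι₁) 0)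

/-- **ROW 17's `harch` AT THE `σ`-TWISTED CENSUS, every `σ`** — the `harch` slot of #56's socket read at the twisted census (`Real34CensusSideT.ofCensusσ`), at
`Z₂ := lineFam V S 0 hpos₂`, `Z₃ := lineFam V S 1 hpos₃`; no hypothesis beyond the context's sign facts `hW`, `hpos₂`, `hpos₃`. -/
theorem harch_datumAtσ :
    ∃ (Tinf : 𝓢((Fin 3 → mixedSpace (↥(maximalRealSubfield (L : Type)))), ℂ) → 𝓢((Fin 3 → mixedSpace (↥(maximalRealSubfield (L : Type)))), ℂ) →
          𝓢((Fin 6 → mixedSpace (↥(maximalRealSubfield (L : Type)))), ℂ))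
      (Tf : FinSB (↥(maximalRealSubfield (L : Type))) (Fin 3) →ₗ[ℂ] FinSB (↥(maximalRealSubfield (L : Type))) (Fin 3) →ₗ[ℂ]
        FinSB (↥(maximalRealSubfield (L : Type))) (Fin 6)),
      (∀ (Φ₂ Φ₃ : 𝓢((Fin 3 → mixedSpace (↥(maximalRealSubfield (L : Type)))), ℂ)) (F₂ F₃ : FinSB (↥(maximalRealSubfield (L : Type))) (Fin 3)),
        tau34 V S (piSchwartzBruhatEquiv (↥(maximalRealSubfield (L : Type))) (Fin 3) (Φ₂ ⊗ₜ F₂))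
            (piSchwartzBruhatEquiv (↥(maximalRealSubfield (L : Type))) (Fin 3) (Φ₃ ⊗ₜ F₃)) =
          piSchwartzBruhatEquiv (↥(maximalRealSubfield (L : Type))) (Fin 6) (Tinf Φ₂ Φ₃ ⊗ₜ Tf F₂ F₃)) ∧
      Submodule.span ℂ (Set.range fun p : FinSB (↥(maximalRealSubfield (L : Type))) (Fin 3) × FinSB (↥(maximalRealSubfield (L : Type))) (Fin 3) =>
        Tf p.1 p.2) = ⊤ ∧
      ∃ a : ℂ, archVec₃₄ V S hGR η (datumAtσ V S jD (jIOf V S hW) σ) m₁ m₂ (printedAtσ V S hW jD m₁ m₂ σ).φ₀ =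
        a • (Tinf (lineFam V S 0 hpos₂ (LinearMap.proj 0)) (lineFam V S 1 hpos₃ (LinearMap.proj 1)) -
          Tinf (lineFam V S 0 hpos₂ (LinearMap.proj 1)) (lineFam V S 1 hpos₃ (LinearMap.proj 0))) := by
  obtain ⟨a'', ha''⟩ := rename_jIAt_detZ_eq_smul_wedgePoly V S hW hpos₂ hpos₃ (not_conjSwapAt_placeUp_cmPlace S hW)
  exact harch_of_insPoly V S hGR η (datumAtσ V S jD (jIOf V S hW) σ) m₁ m₂ hpos₂ hpos₃ _ a''
    ((insPoly_φ₀_datumAtσ V S hW jD m₁ m₂ σ).trans ha'')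

/-- `σ = 1`: **binder-2's printed vacuum (census of record `datumAt`) inserts the `ι₁` determinant letter alone.** -/
theorem insPoly_φ₀_datumAt :
    HypCensus.insPoly (cmPlacesEquiv (L : Type))
        (HypCensus.embOf (L : Type) (frameD V) (frameD_real V) (dW S) (dW_real S) ι₁ (datumAt V S jD (jIOf V S hW)) m₁ m₂)
        (printedAt V S hW jD m₁ m₂).φ₀ =
      rename (atPlace (HypCensus.cmPlace (L : Type) ι₁))
        (rename (jIAt (L : Type) (frameD V) (frameD_real V) (dW S) (dW_real S) ι₁ (frameD_sign_ι₁ V) hW) HodgeCM.PerL34.Fock.detZ) :=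
  insPoly_φ₀_datumAtσ V S hW jD m₁ m₂ 1

/-- `σ = 1`: **ROW 17's `harch` AT THE CENSUS DATA OF RECORD** — the `harch` slot of `Real34CensusSideT.ofCensus` (#56) at
`datum := datumAt V S jD (jIOf V S hW)`, exponents `(m₁, m₂)`, `Z₂ := lineFam V S 0 hpos₂`, `Z₃ := lineFam V S 1 hpos₃`; no hypothesis beyond
the context's sign facts. -/
theorem harch_datumAt :
    ∃ (Tinf : 𝓢((Fin 3 → mixedSpace (↥(maximalRealSubfield (L : Type)))), ℂ) → 𝓢((Fin 3 → mixedSpace (↥(maximalRealSubfield (L : Type)))), ℂ) →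
          𝓢((Fin 6 → mixedSpace (↥(maximalRealSubfield (L : Type)))), ℂ))
      (Tf : FinSB (↥(maximalRealSubfield (L : Type))) (Fin 3) →ₗ[ℂ] FinSB (↥(maximalRealSubfield (L : Type))) (Fin 3) →ₗ[ℂ]
        FinSB (↥(maximalRealSubfield (L : Type))) (Fin 6)),
      (∀ (Φ₂ Φ₃ : 𝓢((Fin 3 → mixedSpace (↥(maximalRealSubfield (L : Type)))), ℂ)) (F₂ F₃ : FinSB (↥(maximalRealSubfield (L : Type))) (Fin 3)),
        tau34 V S (piSchwartzBruhatEquiv (↥(maximalRealSubfield (L : Type))) (Fin 3) (Φ₂ ⊗ₜ F₂))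
            (piSchwartzBruhatEquiv (↥(maximalRealSubfield (L : Type))) (Fin 3) (Φ₃ ⊗ₜ F₃)) =
          piSchwartzBruhatEquiv (↥(maximalRealSubfield (L : Type))) (Fin 6) (Tinf Φ₂ Φ₃ ⊗ₜ Tf F₂ F₃)) ∧
      Submodule.span ℂ (Set.range fun p : FinSB (↥(maximalRealSubfield (L : Type))) (Fin 3) × FinSB (↥(maximalRealSubfield (L : Type))) (Fin 3) =>
        Tf p.1 p.2) = ⊤ ∧
      ∃ a : ℂ, archVec₃₄ V S hGR η (datumAt V S jD (jIOf V S hW)) m₁ m₂ (printedAt V S hW jD m₁ m₂).φ₀ =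
        a • (Tinf (lineFam V S 0 hpos₂ (LinearMap.proj 0)) (lineFam V S 1 hpos₃ (LinearMap.proj 1)) -
          Tinf (lineFam V S 0 hpos₂ (LinearMap.proj 1)) (lineFam V S 1 hpos₃ (LinearMap.proj 0))) :=
  harch_datumAtσ V S hW jD m₁ m₂ 1 hGR η hpos₂ hpos₃

end Pin

end HodgeCM.Model

end
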